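import Literature.ModelTheory.FiniteModelTheory.TseitinColouring
import HarnessLib

/-!
# Degree-three bases for the CFI matching graphs: doubling and cycle replacement of a rotation map

Support file (everything PROVED, no named facts) for the graphs of Dawar–Wilsenach 2025, Thm. 7.2
("a 3-regular graph `Γ` with treewidth at least `k` and `O(k)` vertices … by a standard expander graph
construction"), built over the tree's explicit edge expanders `Expander.Family.X m`
(`RotGraph m d₀`, every `m`). The printed proof needs 3-REGULAR, 2-CONNECTED base graphs of linear
size whose parity (Tseitin/CFI) systems are locally consistent at linear width; the tree's expanders
have large constant degree and half-edges. Two operations on rotation maps repair this: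

* `dbl R` — two copies of `R : RotGraph m d`, the half-edges (`rot δ = δ`) re-routed ACROSS the
  copies and one extra label joining `(v,0)` with `(v,1)`: a `(d+1)`-regular rotation map on
  `Fin (m·2)` WITHOUT half-edges (`noFixed_dbl`), an edge expander if `R` is (`edgeExpansion_dbl`,
  constant `min (1/3) (η/3)`), and 2-dart-connected (`twoLeaving_dbl`: every proper non-empty vertex
  set has at least two leaving darts);
* `cyc R'` — REPLACEMENT PRODUCT WITH A CYCLE: every vertex of `R' : RotGraph n (d+1)` becomes a
  cycle of length `d+1`, the `i`-th cycle vertex carrying the `i`-th dart of `R'`: a `3`-regular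
  rotation map on `Fin (n·(d+1))`, without half-edges if `R'` has none (`noFixed_cyc`), an edge
  expander if `R'` is (`edgeExpansion_cyc`, constant `min 1 (η/(d+3)) / (d+1)`), and 2-dart-connected
  if `R'` is (`twoLeaving_cyc`).

`TwoLeaving` makes every territory graph with a single blocked edge connected
(`reachable_of_twoLeaving`), the form of 2-edge-connectivity used for the matching count.

## References

* A. Dawar, G. Wilsenach, *Symmetric arithmetic circuits*, Theory of Computing 21 (2025), §7.2,
  proof of Thm. 7.2 (p. 24: "By a standard expander graph construction (e.g., [1]), for any `k`, we can
  find a 3-regular graph `Γ` with treewidth at least `k` and `O(k)` vertices").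
* M. Ajtai, *Recursive construction for 3-regular expanders*, Combinatorica 14 (1994) (the source's [1]).
* O. Reingold, S. Vadhan, A. Wigderson, Ann. of Math. 155 (2002), §2.3–2.4 (replacement product).
-/

noncomputable section

open scoped Classical

namespace Literature.ModelTheory.FiniteModelTheory.CFIMatching

open Finset
open Literature.Computability.Complexity.Expander (RotGraph)
open TseitinColouring (EdgeExpansion Dart terr comp mem_comp mem_comp_self mem_of_leaving)

/-! ### Leaving darts, half-edges, 2-dart-connectivity -/

section Generic

variable {N D : ℕ} (G : RotGraph N D)

/-- The darts leaving a vertex set. [folklore] -/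
def leaving (Q : Finset (Fin N)) : Finset (Fin N × Fin D) :=
  univ.filter fun x => x.1 ∈ Q ∧ G.nbr x.1 x.2 ∉ Q

/-- Membership in `leaving`. [folklore] -/
theorem mem_leaving {Q : Finset (Fin N)} {x : Fin N × Fin D} : x ∈ leaving G Q ↔ x.1 ∈ Q ∧ G.nbr x.1 x.2 ∉ Q := by
  simp [leaving]

/-- `G` has NO HALF-EDGES: the rotation map has no fixed dart. [folklore] -/
def NoFixed (G : RotGraph N D) : Prop := ∀ x, G.rot x ≠ x

/-- `G` is 2-DART-CONNECTED: every proper non-empty vertex set has at least two leaving darts.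
[folklore] -/
def TwoLeaving (G : RotGraph N D) : Prop :=
  ∀ Q : Finset (Fin N), Q.Nonempty → Q ≠ univ → 2 ≤ (leaving G Q).card

/-- Reversing a leaving dart of `Q` gives a leaving dart of the complement. [folklore] -/
theorem rot_mem_leaving_compl {Q : Finset (Fin N)} {x : Fin N × Fin D} (hx : x ∈ leaving G Q) :
    G.rot x ∈ leaving G Qᶜ := by
  rw [mem_leaving] at hx ⊢
  refine ⟨by rw [Finset.mem_compl]; exact hx.2, ?_⟩
  rw [Finset.mem_compl, not_not]
  have : G.nbr (G.rot x).1 (G.rot x).2 = x.1 := by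
    show (G.rot (G.rot x)).1 = x.1; rw [G.rot_rot]
  rw [this]; exact hx.1

/-- Leaving darts of the complement are at least as many (reverse them). [folklore] -/
theorem card_leaving_compl_le (Q : Finset (Fin N)) : (leaving G Q).card ≤ (leaving G Qᶜ).card := by
  refine Finset.card_le_card_of_injOn G.rot (fun x hx => rot_mem_leaving_compl G hx) fun x _ y _ h => ?_
  have := congrArg G.rot h
  rwa [G.rot_rot, G.rot_rot] at this

/-- **An edge expander has a leaving dart from every proper non-empty set.** [folklore] -/
theorem one_le_card_leaving {η : ℝ} (hG : EdgeExpansion G η) {Q : Finset (Fin N)} (hQ : Q.Nonempty)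
    (hQ' : Q ≠ univ) : 1 ≤ (leaving G Q).card := by
  by_cases h : 2 * Q.card ≤ N
  · have h1 := hG.expand Q h
    have hpos : (0 : ℝ) < η * Q.card := mul_pos hG.pos (by exact_mod_cast Finset.card_pos.2 hQ)
    have : (0 : ℝ) < ((leaving G Q).card : ℝ) := hpos.trans_le h1
    exact_mod_cast this
  · have hc : 2 * Qᶜ.card ≤ N := by
      rw [Finset.card_compl, Fintype.card_fin]
      have := Finset.card_le_univ Q; rw [Fintype.card_fin] at this; omega
    have hne : Qᶜ.Nonempty := by
      rw [Finset.nonempty_iff_ne_empty, Ne, Finset.compl_eq_empty_iff]; exact hQ'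
    have h1 := hG.expand Qᶜ hc
    have hpos : (0 : ℝ) < η * Qᶜ.card := mul_pos hG.pos (by exact_mod_cast Finset.card_pos.2 hne)
    have h2 : (0 : ℝ) < ((leaving G Qᶜ).card : ℝ) := hpos.trans_le h1
    have h3 : 1 ≤ (leaving G Qᶜ).card := by exact_mod_cast h2
    have h4 := card_leaving_compl_le G Qᶜ
    rw [compl_compl] at h4
    exact h3.trans h4

/-- **With one blocked edge a 2-dart-connected rotation map stays connected**: all vertices are
mutually reachable in the territory graph of `{δ₀, rot δ₀}`. [folklore] -/
theorem reachable_of_twoLeaving (hG : TwoLeaving G) (δ₀ : Fin N × Fin D) (u w : Fin N) :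
    (terr G {δ₀, G.rot δ₀}).Reachable u w := by
  set Dset : Finset (Fin N × Fin D) := {δ₀, G.rot δ₀} with hD
  have hDrot : ∀ δ ∈ Dset, G.rot δ ∈ Dset := by
    intro δ hδ
    simp only [hD, Finset.mem_insert, Finset.mem_singleton] at hδ ⊢
    rcases hδ with rfl | rfl
    · exact Or.inr rfl
    · exact Or.inl (G.rot_rot _)
  by_contra hw
  have hne : (comp G Dset u).Nonempty := ⟨u, mem_comp_self G Dset u⟩
  have hnu : comp G Dset u ≠ univ := by
    intro h
    have : w ∈ comp G Dset u := by rw [h]; exact mem_univ w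
    exact hw ((mem_comp G).1 this)
  have h2 := hG _ hne hnu
  obtain ⟨x, hx, y, hy, hxy⟩ := Finset.one_lt_card.1 h2
  rw [mem_leaving] at hx hy
  have hxD : x ∈ Dset := mem_of_leaving G hDrot hx.1 hx.2
  have hyD : y ∈ Dset := mem_of_leaving G hDrot hy.1 hy.2
  -- the two blocked darts are reverse to each other, so they cannot both leave the component
  have key : ∀ x y : Fin N × Fin D, x.1 ∈ comp G Dset u → G.nbr x.1 x.2 ∉ comp G Dset u →
      y.1 ∈ comp G Dset u → y = G.rot x → False := by
    rintro x y hx1 hx2 hy1 rfl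
    exact hx2 hy1
  simp only [hD, Finset.mem_insert, Finset.mem_singleton] at hxD hyD
  rcases hxD with rfl | rfl <;> rcases hyD with rfl | rfl
  · exact hxy rfl
  · exact key _ _ hx.1 hx.2 hy.1 rfl
  · exact key _ _ hy.1 hy.2 hx.1 rfl
  · exact hxy rfl

/-- A 2-dart-connected rotation map is connected (no darts blocked). [folklore] -/
theorem reachable_of_twoLeaving_empty (hG : TwoLeaving G) (u w : Fin N) :
    (terr G ∅).Reachable u w := by
  rcases isEmpty_or_nonempty (Fin N × Fin D) with h | ⟨⟨δ₀⟩⟩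
  · -- no darts at all: `D = 0` or `N = 0`; with `N ≥ 1` (we have `u`) every set is its own component,
    -- so `TwoLeaving` forces `N = 1`
    by_contra huw
    have hne : ({u} : Finset (Fin N)).Nonempty := ⟨u, mem_singleton_self u⟩
    have hnu : ({u} : Finset (Fin N)) ≠ univ := by
      intro h
      have : w ∈ ({u} : Finset (Fin N)) := by rw [h]; exact mem_univ w
      rw [mem_singleton] at this
      exact huw (this ▸ SimpleGraph.Reachable.rfl)
    have := hG _ hne hnu
    have h0 : (leaving G {u}).card = 0 := by
      rw [Finset.card_eq_zero, Finset.eq_empty_iff_forall_notMem]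
      intro x _; exact h.elim x
    omega
  · exact ((reachable_of_twoLeaving G hG δ₀ u w).mono (TseitinColouring.terr_mono G (Finset.empty_subset _)))

end Generic

/-! ### Rotation maps on product vertex sets, transported to `Fin` -/

section OfFun

variable {α : Type*} {N D : ℕ} (e : α ≃ Fin N) (f : α × Fin D → α × Fin D)
  (hf : Function.Involutive f)

/-- A rotation map given on a vertex type `α ≃ Fin N`. [folklore] -/
def ofFun : RotGraph N D where
  rot x := Prod.map e id (f (Prod.map e.symm id x))
  rot_rot x := by
    show Prod.map e id (f (Prod.map e.symm id (Prod.map e id (f (Prod.map e.symm id x))))) = x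
    have h1 : Prod.map (⇑e.symm) id (Prod.map (⇑e) id (f (Prod.map (⇑e.symm) id x))) = f (Prod.map e.symm id x) := by
      ext <;> simp
    rw [h1, hf]
    ext <;> simp

/-- The rotation map of `ofFun`. [folklore] -/
theorem ofFun_rot (x : Fin N × Fin D) : (ofFun e f hf).rot x = Prod.map e id (f (Prod.map e.symm id x)) := rfl

/-- The rotation map of `ofFun` on a transported dart. [folklore] -/
theorem ofFun_rot_map (y : α × Fin D) : (ofFun e f hf).rot (Prod.map e id y) = Prod.map e id (f y) := by
  rw [ofFun_rot]
  congr 2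
  ext <;> simp

/-- `ofFun` has no half-edges iff `f` has no fixed point. [folklore] -/
theorem noFixed_ofFun (h : ∀ y, f y ≠ y) : NoFixed (ofFun e f hf) := by
  intro x hx
  apply h (Prod.map e.symm id x)
  have := congrArg (Prod.map e.symm id) hx
  rw [ofFun_rot] at this
  have h1 : Prod.map (⇑e.symm) id (Prod.map (⇑e) id (f (Prod.map (⇑e.symm) id x))) = f (Prod.map e.symm id x) := by
    ext <;> simp
  rw [h1] at this
  exact this

variable [Fintype α]

/-- The leaving darts of a set, counted on `α`. [folklore] -/
def leavingF (Q : Finset α) : Finset (α × Fin D) := univ.filter fun y => y.1 ∈ Q ∧ (f y).1 ∉ Q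

/-- Membership in `leavingF`. [folklore] -/
theorem mem_leavingF {Q : Finset α} {y : α × Fin D} : y ∈ leavingF f Q ↔ y.1 ∈ Q ∧ (f y).1 ∉ Q := by
  simp [leavingF]

/-- **Leaving darts of the transported rotation map are the transported leaving darts.** [folklore] -/
theorem card_leaving_ofFun (Q : Finset (Fin N)) :
    (leaving (ofFun e f hf) Q).card = (leavingF f (Q.map e.symm.toEmbedding)).card := by
  refine (Finset.card_bij (fun y _ => Prod.map e id y) (fun y hy => ?_) (fun y _ y' _ h => ?_) (fun x hx => ?_)).symm
  · rw [mem_leavingF] at hy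
    rw [mem_leaving]
    refine ⟨?_, ?_⟩
    · have := hy.1; rw [Finset.mem_map_equiv] at this; simpa using this
    · intro h
      apply hy.2
      rw [Finset.mem_map_equiv]
      have hn : (ofFun e f hf).nbr (Prod.map (⇑e) id y).1 (Prod.map (⇑e) id y).2 = e (f y).1 := by
        show ((ofFun e f hf).rot (Prod.map e id y)).1 = _
        rw [ofFun_rot_map]; rfl
      rw [hn] at h
      simpa using h
  · have := congrArg (Prod.map e.symm id) h
    simpa [Prod.map] using this
  · refine ⟨Prod.map e.symm id x, ?_, by ext <;> simp⟩
    rw [mem_leaving] at hx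
    rw [mem_leavingF]
    refine ⟨by rw [Finset.mem_map_equiv]; simpa using hx.1, fun h => hx.2 ?_⟩
    rw [Finset.mem_map_equiv] at h
    have hn : (ofFun e f hf).nbr x.1 x.2 = e (f (Prod.map e.symm id x)).1 := by
      show ((ofFun e f hf).rot x).1 = _
      rw [ofFun_rot]; rfl
    rw [hn]
    simpa using h

/-- Edge expansion of `ofFun` from a bound on `α`. [folklore] -/
theorem edgeExpansion_ofFun {η : ℝ} (hη : 0 < η)
    (h : ∀ Q : Finset α, 2 * Q.card ≤ N → η * Q.card ≤ ((leavingF f Q).card : ℝ)) :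
    EdgeExpansion (ofFun e f hf) η := by
  refine ⟨hη, fun Q hQ => ?_⟩
  have hc : (Q.map e.symm.toEmbedding).card = Q.card := Finset.card_map _
  have := h (Q.map e.symm.toEmbedding) (by rw [hc]; exact hQ)
  rw [hc] at this
  rw [show ((univ.filter fun x : Fin N × Fin D => x.1 ∈ Q ∧ (ofFun e f hf).nbr x.1 x.2 ∉ Q).card : ℝ) =
    ((leaving (ofFun e f hf) Q).card : ℝ) from rfl, card_leaving_ofFun]
  exact this

/-- 2-dart-connectivity of `ofFun` from the property on `α`. [folklore] -/
theorem twoLeaving_ofFun (h : ∀ Q : Finset α, Q.Nonempty → Q ≠ univ → 2 ≤ (leavingF f Q).card) :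
    TwoLeaving (ofFun e f hf) := by
  intro Q hQ hQ'
  rw [card_leaving_ofFun]
  refine h _ (hQ.map) fun huniv => hQ' ?_
  rw [Finset.eq_univ_iff_forall]
  intro x
  have : e.symm x ∈ Q.map e.symm.toEmbedding := by rw [huniv]; exact mem_univ _
  rw [Finset.mem_map_equiv] at this
  simpa using this

end OfFun

/-! ### Doubling: two copies, half-edges re-routed across, plus a perfect matching -/

section Dbl

variable {m d : ℕ} (R : RotGraph m d)

/-- `t + 1 + 1 = t` in `Fin 2`. [folklore] -/
theorem fin2_add_one_add_one (t : Fin 2) : t + 1 + 1 = t := by fin_cases t <;> rfl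

/-- The two elements of `Fin 2`. [folklore] -/
theorem fin2_eq (t : Fin 2) : t = 0 ∨ t = 1 := by fin_cases t <;> simp

/-- `t + 1 ≠ t` in `Fin 2`. [folklore] -/
theorem fin2_add_one_ne (t : Fin 2) : t + 1 ≠ t := by fin_cases t <;> decide

/-- The rotation map of the DOUBLE of `R` on `(Fin m × Fin 2) × Fin (d+1)`: a dart `i < d` of `R`
that is not a half-edge acts inside each copy; a half-edge `i` of `R` and the new label `d` join the
two copies of their vertex. [folklore] -/
def dblFun (x : (Fin m × Fin 2) × Fin (d + 1)) : (Fin m × Fin 2) × Fin (d + 1) :=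
  if h : (x.2 : ℕ) < d then
    if R.rot (x.1.1, ⟨x.2, h⟩) = (x.1.1, ⟨x.2, h⟩) then ((x.1.1, x.1.2 + 1), x.2)
    else (((R.rot (x.1.1, ⟨x.2, h⟩)).1, x.1.2), Fin.castSucc (R.rot (x.1.1, ⟨x.2, h⟩)).2)
  else ((x.1.1, x.1.2 + 1), x.2)

/-- `dblFun` on a copied non-half-edge dart. [folklore] -/
theorem dblFun_real {v : Fin m} {i : Fin d} (hi : R.rot (v, i) ≠ (v, i)) (t : Fin 2) :
    dblFun R ((v, t), Fin.castSucc i) = (((R.rot (v, i)).1, t), Fin.castSucc (R.rot (v, i)).2) := by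
  unfold dblFun
  have h : ((Fin.castSucc i : Fin (d + 1)) : ℕ) < d := i.2
  have hi' : (⟨((Fin.castSucc i : Fin (d + 1)) : ℕ), h⟩ : Fin d) = i := Fin.ext rfl
  rw [dif_pos h]
  simp only [hi']
  rw [if_neg hi]

/-- `dblFun` on a copied half-edge dart. [folklore] -/
theorem dblFun_fixed {v : Fin m} {i : Fin d} (hi : R.rot (v, i) = (v, i)) (t : Fin 2) :
    dblFun R ((v, t), Fin.castSucc i) = ((v, t + 1), Fin.castSucc i) := by
  unfold dblFun
  have h : ((Fin.castSucc i : Fin (d + 1)) : ℕ) < d := i.2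
  have hi' : (⟨((Fin.castSucc i : Fin (d + 1)) : ℕ), h⟩ : Fin d) = i := Fin.ext rfl
  rw [dif_pos h]
  simp only [hi']
  rw [if_pos hi]

/-- `dblFun` on a matching dart. [folklore] -/
theorem dblFun_last (v : Fin m) (t : Fin 2) : dblFun R ((v, t), Fin.last d) = ((v, t + 1), Fin.last d) := by
  unfold dblFun
  rw [dif_neg (by simp)]

/-- Every label of `Fin (d+1)` is a copied label or the matching label. [folklore] -/
theorem fin_succ_cases (i : Fin (d + 1)) : (∃ j : Fin d, i = Fin.castSucc j) ∨ i = Fin.last d := by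
  rcases Fin.eq_castSucc_or_eq_last i with ⟨j, rfl⟩ | rfl
  · exact Or.inl ⟨j, rfl⟩
  · exact Or.inr rfl

/-- `dblFun` is an involution. [folklore] -/
theorem dblFun_involutive : Function.Involutive (dblFun R) := by
  rintro ⟨⟨v, t⟩, i⟩
  rcases fin_succ_cases i with ⟨j, rfl⟩ | rfl
  · by_cases hj : R.rot (v, j) = (v, j)
    · rw [dblFun_fixed R hj, dblFun_fixed R hj, fin2_add_one_add_one]
    · rw [dblFun_real R hj]
      have hrot : R.rot ((R.rot (v, j)).1, (R.rot (v, j)).2) = (v, j) := R.rot_rot (v, j)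
      have hj' : R.rot ((R.rot (v, j)).1, (R.rot (v, j)).2) ≠ ((R.rot (v, j)).1, (R.rot (v, j)).2) := by
        rw [hrot]; intro h; exact hj (h.trans Prod.mk.eta).symm
      rw [dblFun_real R hj', hrot]
  · rw [dblFun_last, dblFun_last, fin2_add_one_add_one]

/-- `dblFun` has no fixed dart. [folklore] -/
theorem dblFun_ne (x : (Fin m × Fin 2) × Fin (d + 1)) : dblFun R x ≠ x := by
  obtain ⟨⟨v, t⟩, i⟩ := x
  rcases fin_succ_cases i with ⟨j, rfl⟩ | rfl
  · by_cases hj : R.rot (v, j) = (v, j)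
    · rw [dblFun_fixed R hj]
      intro h
      have := congrArg (fun x => x.1.2) h
      exact fin2_add_one_ne t this
    · rw [dblFun_real R hj]
      intro h
      apply hj
      have h1 := congrArg (fun x => x.1.1) h
      have h2 := congrArg (fun x => (x.2 : ℕ)) h
      simp only [Fin.val_castSucc] at h1 h2
      exact Prod.ext h1 (Fin.ext h2)
  · rw [dblFun_last]
    intro h
    have := congrArg (fun x => x.1.2) h
    exact fin2_add_one_ne t this

/-- **The double** `dbl R : RotGraph (m·2) (d+1)`. [folklore] -/
def dbl : RotGraph (m * 2) (d + 1) := ofFun finProdFinEquiv (dblFun R) (dblFun_involutive R)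

/-- The double has no half-edges. [folklore] -/
theorem noFixed_dbl : NoFixed (dbl R) := noFixed_ofFun _ _ _ (dblFun_ne R)

/-- The copy-`t` slice of a vertex set of the double. [folklore] -/
def slice (Q : Finset (Fin m × Fin 2)) (t : Fin 2) : Finset (Fin m) := univ.filter fun v => (v, t) ∈ Q

/-- Membership in a slice. [folklore] -/
theorem mem_slice {Q : Finset (Fin m × Fin 2)} {t : Fin 2} {v : Fin m} : v ∈ slice Q t ↔ (v, t) ∈ Q := by
  simp [slice]

/-- A vertex set of the double is the disjoint union of its two slices. [folklore] -/
theorem card_eq_slices (Q : Finset (Fin m × Fin 2)) : Q.card = (slice Q 0).card + (slice Q 1).card := by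
  rw [Finset.card_eq_sum_card_fiberwise (f := fun x : Fin m × Fin 2 => x.2) (t := univ) (fun _ _ => mem_univ _),
    Fin.sum_univ_two]
  congr 1 <;> refine Finset.card_bij (fun x _ => x.1) (fun x hx => ?_) (fun x hx y hy h => ?_) (fun v hv => ?_)
  · rw [Finset.mem_filter] at hx; rw [mem_slice, ← hx.2]; exact hx.1
  · rw [Finset.mem_filter] at hx hy; exact Prod.ext h (hx.2.trans hy.2.symm)
  · exact ⟨(v, 0), Finset.mem_filter.2 ⟨(mem_slice).1 hv, rfl⟩, rfl⟩
  · rw [Finset.mem_filter] at hx; rw [mem_slice, ← hx.2]; exact hx.1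
  · rw [Finset.mem_filter] at hx hy; exact Prod.ext h (hx.2.trans hy.2.symm)
  · exact ⟨(v, 1), Finset.mem_filter.2 ⟨(mem_slice).1 hv, rfl⟩, rfl⟩

/-- The vertices of `Q` whose twin is outside `Q` (their matching dart leaves). [folklore] -/
def twinOut (Q : Finset (Fin m × Fin 2)) : Finset (Fin m × Fin 2) := Q.filter fun x => (x.1, x.2 + 1) ∉ Q

/-- A slice difference injects into `twinOut`. [folklore] -/
theorem card_sdiff_slice_le (Q : Finset (Fin m × Fin 2)) (t : Fin 2) :
    (slice Q t \ slice Q (t + 1)).card ≤ (twinOut Q).card := by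
  refine Finset.card_le_card_of_injOn (fun v => (v, t)) (fun v hv => ?_) (fun v _ w _ h => (Prod.ext_iff.1 h).1)
  rw [Finset.mem_coe, Finset.mem_sdiff, mem_slice, mem_slice] at hv
  exact Finset.mem_filter.2 ⟨hv.1, hv.2⟩

/-- **Lower bound for the leaving darts of the double**: the matching darts of `twinOut Q` and the
copies of the leaving darts of the two slices. [folklore] -/
theorem card_leavingF_dbl_ge (Q : Finset (Fin m × Fin 2)) :
    (twinOut Q).card + (leaving R (slice Q 0)).card + (leaving R (slice Q 1)).card ≤ (leavingF (dblFun R) Q).card := by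
  -- three disjoint families of leaving darts
  let S₁ : Finset ((Fin m × Fin 2) × Fin (d + 1)) := (twinOut Q).map ⟨fun x => (x, Fin.last d), fun x y h => (Prod.ext_iff.1 h).1⟩
  let S : Fin 2 → Finset ((Fin m × Fin 2) × Fin (d + 1)) := fun t => (leaving R (slice Q t)).map
    ⟨fun y => ((y.1, t), Fin.castSucc y.2), fun y y' h => by
      simp only [Prod.mk.injEq, Fin.castSucc_inj] at h
      exact Prod.ext h.1.1 h.2⟩
  have hS₁ : S₁ ⊆ leavingF (dblFun R) Q := by
    intro z hz
    rw [Finset.mem_map] at hz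
    obtain ⟨x, hx, rfl⟩ := hz
    rw [twinOut, Finset.mem_filter] at hx
    rw [mem_leavingF]
    refine ⟨hx.1, ?_⟩
    show (dblFun R ((x.1, x.2), Fin.last d)).1 ∉ Q
    rw [dblFun_last]; exact hx.2
  have hS : ∀ t, S t ⊆ leavingF (dblFun R) Q := by
    intro t z hz
    rw [Finset.mem_map] at hz
    obtain ⟨y, hy, rfl⟩ := hz
    rw [mem_leaving, mem_slice] at hy
    have hreal : R.rot (y.1, y.2) ≠ (y.1, y.2) := by
      intro h
      apply hy.2
      rw [mem_slice, RotGraph.nbr, h]; exact hy.1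
    rw [mem_leavingF]
    refine ⟨hy.1, ?_⟩
    show (dblFun R ((y.1, t), Fin.castSucc y.2)).1 ∉ Q
    rw [dblFun_real R hreal]
    exact fun h => hy.2 ((mem_slice).2 h)
  have hd₁ : ∀ t, Disjoint S₁ (S t) := by
    intro t
    rw [Finset.disjoint_left]
    rintro z hz hz'
    rw [Finset.mem_map] at hz hz'
    obtain ⟨x, -, rfl⟩ := hz
    obtain ⟨y, -, h⟩ := hz'
    have := congrArg (fun z => (z.2 : ℕ)) h
    simp only [Function.Embedding.coeFn_mk, Fin.val_castSucc, Fin.val_last] at this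
    exact absurd this (ne_of_lt y.2.2)
  have hd : Disjoint (S 0) (S 1) := by
    rw [Finset.disjoint_left]
    rintro z hz hz'
    rw [Finset.mem_map] at hz hz'
    obtain ⟨x, -, rfl⟩ := hz
    obtain ⟨y, -, h⟩ := hz'
    have := congrArg (fun z => z.1.2) h
    simp at this
  calc (twinOut Q).card + (leaving R (slice Q 0)).card + (leaving R (slice Q 1)).card
      = S₁.card + (S 0).card + (S 1).card := by simp only [S₁, S, Finset.card_map]
    _ = (S₁ ∪ S 0 ∪ S 1).card := by
        rw [Finset.card_union_of_disjoint (Finset.disjoint_union_left.2 ⟨hd₁ 1, hd⟩),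
          Finset.card_union_of_disjoint (hd₁ 0)]
    _ ≤ (leavingF (dblFun R) Q).card :=
        Finset.card_le_card (Finset.union_subset (Finset.union_subset hS₁ (hS 0)) (hS 1))

/-- **The double of an edge expander is an edge expander** (constant `min (1/3) (η/3)`). [folklore] -/
theorem leavingF_dbl_expand {η : ℝ} (hR : EdgeExpansion R η) (Q : Finset (Fin m × Fin 2))
    (hQ : 2 * Q.card ≤ m * 2) : min (1 / 3) (η / 3) * Q.card ≤ ((leavingF (dblFun R) Q).card : ℝ) := by
  have hη := hR.pos
  have hge := card_leavingF_dbl_ge R Q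
  set a := (slice Q 0).card with ha
  set b := (slice Q 1).card with hb
  have hab : Q.card = a + b := card_eq_slices Q
  have hs0 : a - b ≤ (twinOut Q).card := (Finset.le_card_sdiff _ _).trans (card_sdiff_slice_le Q 0)
  have hs1 : b - a ≤ (twinOut Q).card :=
    (Finset.le_card_sdiff _ _).trans (by have := card_sdiff_slice_le Q 1; rwa [show (1 : Fin 2) + 1 = 0 from rfl] at this)
  have hmin1 : min (1 / 3) (η / 3) ≤ 1 / 3 := min_le_left _ _
  have hmin2 : min (1 / 3) (η / 3) ≤ η / 3 := min_le_right _ _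
  have hmin0 : 0 ≤ min (1 / 3) (η / 3) := le_min (by norm_num) (by linarith)
  have hL : ((twinOut Q).card : ℝ) + (leaving R (slice Q 0)).card + (leaving R (slice Q 1)).card ≤
      (leavingF (dblFun R) Q).card := by exact_mod_cast hge
  rw [hab, Nat.cast_add]
  by_cases h0 : 2 * a ≤ m
  · by_cases h1 : 2 * b ≤ m
    · have e0 := hR.expand _ h0
      have e1 := hR.expand _ h1
      change η * a ≤ ((leaving R (slice Q 0)).card : ℝ) at e0
      change η * b ≤ ((leaving R (slice Q 1)).card : ℝ) at e1
      have : (0 : ℝ) ≤ (twinOut Q).card := Nat.cast_nonneg _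
      nlinarith
    · -- copy `1` is big, copy `0` is small
      have e0 := hR.expand _ h0
      change η * a ≤ ((leaving R (slice Q 0)).card : ℝ) at e0
      have hs : ((b - a : ℕ) : ℝ) ≤ (twinOut Q).card := by exact_mod_cast hs1
      have hba : a ≤ b := by omega
      rw [Nat.cast_sub hba] at hs
      have : (0 : ℝ) ≤ (leaving R (slice Q 1)).card := Nat.cast_nonneg _
      by_cases h2 : 2 * a ≤ b
      · have : (2 : ℝ) * a ≤ b := by exact_mod_cast h2
        nlinarith
      · have : (b : ℝ) < 2 * a := by exact_mod_cast (not_le.1 h2)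
        nlinarith
  · have h1 : 2 * b ≤ m := by omega
    have e1 := hR.expand _ h1
    change η * b ≤ ((leaving R (slice Q 1)).card : ℝ) at e1
    have hs : ((a - b : ℕ) : ℝ) ≤ (twinOut Q).card := by exact_mod_cast hs0
    have hba : b ≤ a := by omega
    rw [Nat.cast_sub hba] at hs
    have : (0 : ℝ) ≤ (leaving R (slice Q 0)).card := Nat.cast_nonneg _
    by_cases h2 : 2 * b ≤ a
    · have : (2 : ℝ) * b ≤ a := by exact_mod_cast h2
      nlinarith
    · have : (a : ℝ) < 2 * b := by exact_mod_cast (not_le.1 h2)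
      nlinarith

/-- **Edge expansion of the double.** [folklore] -/
theorem edgeExpansion_dbl {η : ℝ} (hR : EdgeExpansion R η) : EdgeExpansion (dbl R) (min (1 / 3) (η / 3)) :=
  edgeExpansion_ofFun _ _ _ (lt_min (by norm_num) (by linarith [hR.pos])) fun Q hQ => leavingF_dbl_expand R hR Q hQ

/-- **The double of an edge expander on `m ≥ 2` vertices is 2-dart-connected.** [folklore] -/
theorem twoLeaving_dbl {η : ℝ} (hR : EdgeExpansion R η) (hm : 2 ≤ m) : TwoLeaving (dbl R) := by
  refine twoLeaving_ofFun _ _ _ fun Q hQ hQu => ?_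
  refine le_trans ?_ (card_leavingF_dbl_ge R Q)
  by_cases heq : slice Q 0 = slice Q 1
  · -- the same set in both copies: it is proper and non-empty, so each copy has a leaving dart
    have hne : (slice Q 0).Nonempty := by
      obtain ⟨⟨v, t⟩, hv⟩ := hQ
      rcases fin2_eq t with rfl | rfl
      · exact ⟨v, (mem_slice).2 hv⟩
      · exact ⟨v, by rw [heq]; exact (mem_slice).2 hv⟩
    have hnu : slice Q 0 ≠ univ := by
      intro h
      apply hQu
      rw [Finset.eq_univ_iff_forall]
      rintro ⟨v, t⟩
      rcases fin2_eq t with rfl | rfl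
      · exact (mem_slice).1 (by rw [h]; exact mem_univ v)
      · exact (mem_slice).1 (by rw [← heq, h]; exact mem_univ v)
    have h0 := one_le_card_leaving R hR hne hnu
    have h1 : 1 ≤ (leaving R (slice Q 1)).card := by rw [← heq]; exact h0
    omega
  · -- different slices: a matching dart leaves; and one more dart
    have hs : 1 ≤ (twinOut Q).card := by
      rw [Nat.one_le_iff_ne_zero, Ne, Finset.card_eq_zero, ← Ne, ← Finset.nonempty_iff_ne_empty]
      by_contra hempty
      rw [Finset.not_nonempty_iff_eq_empty] at hempty
      apply heq
      ext v
      rw [mem_slice, mem_slice]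
      constructor <;> intro hv <;> by_contra hv'
      · have : (v, (0 : Fin 2)) ∈ twinOut Q := Finset.mem_filter.2 ⟨hv, hv'⟩
        rw [hempty] at this; simp at this
      · have : (v, (1 : Fin 2)) ∈ twinOut Q := Finset.mem_filter.2 ⟨hv, hv'⟩
        rw [hempty] at this; simp at this
    by_cases hp0 : (slice Q 0).Nonempty ∧ slice Q 0 ≠ univ
    · have := one_le_card_leaving R hR hp0.1 hp0.2; omega
    · by_cases hp1 : (slice Q 1).Nonempty ∧ slice Q 1 ≠ univ
      · have := one_le_card_leaving R hR hp1.1 hp1.2; omega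
      · -- both slices are `∅` or `univ`, and they differ: `Q` is one full copy
        have htwin : twinOut Q = Q := by
          refine Finset.filter_true_of_mem fun x hx hx' => ?_
          rw [not_and_or, Finset.not_nonempty_iff_eq_empty, not_not] at hp0 hp1
          have hx0 := (mem_slice (t := x.2)).2 (show (x.1, x.2) ∈ Q from hx)
          have hx1 := (mem_slice (t := x.2 + 1)).2 hx'
          apply heq
          obtain ⟨v, t⟩ := x
          rcases fin2_eq t with rfl | rfl
          · -- slice 0 and slice 1 both nonempty, hence both univ
            rcases hp0 with h | h
            · rw [h] at hx0; simp at hx0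
            · rcases hp1 with h' | h'
              · change v ∈ slice Q (0 + 1) at hx1
                rw [show (0 : Fin 2) + 1 = 1 from rfl, h'] at hx1; simp at hx1
              · rw [h, h']
          · rcases hp1 with h' | h'
            · change v ∈ slice Q 1 at hx0
              rw [h'] at hx0; simp at hx0
            · rcases hp0 with h | h
              · change v ∈ slice Q (1 + 1) at hx1
                rw [show (1 : Fin 2) + 1 = 0 from rfl, h] at hx1; simp at hx1
              · rw [h, h']
        rw [htwin, card_eq_slices]
        rw [not_and_or, Finset.not_nonempty_iff_eq_empty, not_not] at hp0 hp1
        rcases hp0 with h0 | h0 <;> rcases hp1 with h1 | h1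
        · exfalso; apply heq; rw [h0, h1]
        · rw [h0, h1, Finset.card_empty, Finset.card_univ, Fintype.card_fin]; omega
        · rw [h0, h1, Finset.card_empty, Finset.card_univ, Fintype.card_fin]; omega
        · exfalso; apply heq; rw [h0, h1]

/-- The double has `m · 2` vertices and degree `d + 1`. [folklore] -/
theorem dbl_vertices : Fintype.card (Fin (m * 2)) = m * 2 := Fintype.card_fin _

end Dbl

/-! ### Replacement product with a cycle: a 3-regular rotation map -/

section Cyc

variable {n d : ℕ} (R' : RotGraph n (d + 1))

/-- An element of `Fin 3` other than `0` and `1` is `2`. [folklore] -/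
theorem fin3_eq_two {k : Fin 3} (h0 : k ≠ 0) (h1 : k ≠ 1) : k = 2 := by
  fin_cases k <;> simp_all

/-- The rotation map of the CYCLE REPLACEMENT of `R'` on `(Fin n × Fin (d+1)) × Fin 3`: the vertex
`(v, i)` is the `i`-th vertex of the cycle replacing `v`; label `0` goes to the previous, label `1`
to the next cycle vertex, label `2` along the `i`-th dart of `R'`. [folklore] -/
def cycFun (x : (Fin n × Fin (d + 1)) × Fin 3) : (Fin n × Fin (d + 1)) × Fin 3 :=
  if x.2 = 0 then ((x.1.1, x.1.2 - 1), 1)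
  else if x.2 = 1 then ((x.1.1, x.1.2 + 1), 0)
  else (R'.rot x.1, 2)

/-- `cycFun` on label `0`. [folklore] -/
theorem cycFun_zero (y : Fin n × Fin (d + 1)) : cycFun R' (y, 0) = ((y.1, y.2 - 1), 1) := by
  simp [cycFun]

/-- `cycFun` on label `1`. [folklore] -/
theorem cycFun_one (y : Fin n × Fin (d + 1)) : cycFun R' (y, 1) = ((y.1, y.2 + 1), 0) := by
  simp [cycFun]

/-- `cycFun` on label `2`. [folklore] -/
theorem cycFun_two (y : Fin n × Fin (d + 1)) : cycFun R' (y, 2) = (R'.rot y, 2) := by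
  simp [cycFun]

/-- `cycFun` is an involution. [folklore] -/
theorem cycFun_involutive : Function.Involutive (cycFun R') := by
  rintro ⟨y, k⟩
  by_cases h0 : k = 0
  · subst h0; rw [cycFun_zero, cycFun_one]; simp
  · by_cases h1 : k = 1
    · subst h1; rw [cycFun_one, cycFun_zero]; simp
    · obtain rfl := fin3_eq_two h0 h1
      rw [cycFun_two, cycFun_two, R'.rot_rot]

/-- `cycFun` has no fixed dart if `R'` has no half-edge. [folklore] -/
theorem cycFun_ne (hR' : NoFixed R') (x : (Fin n × Fin (d + 1)) × Fin 3) : cycFun R' x ≠ x := by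
  obtain ⟨y, k⟩ := x
  by_cases h0 : k = 0
  · subst h0; rw [cycFun_zero]; intro h; have := congrArg Prod.snd h; simp at this
  · by_cases h1 : k = 1
    · subst h1; rw [cycFun_one]; intro h; have := congrArg Prod.snd h; simp at this
    · obtain rfl := fin3_eq_two h0 h1
      rw [cycFun_two]; intro h; exact hR' y (congrArg Prod.fst h)

/-- **The cycle replacement** `cyc R' : RotGraph (n·(d+1)) 3`. [folklore] -/
def cyc : RotGraph (n * (d + 1)) 3 := ofFun finProdFinEquiv (cycFun R') (cycFun_involutive R')

/-- The cycle replacement has no half-edges if `R'` has none. [folklore] -/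
theorem noFixed_cyc (hR' : NoFixed R') : NoFixed (cyc R') := noFixed_ofFun _ _ _ (cycFun_ne R' hR')

/-- The part of a vertex set of the cycle replacement inside the cycle of `v`. [folklore] -/
def fibre (Q : Finset (Fin n × Fin (d + 1))) (v : Fin n) : Finset (Fin (d + 1)) := univ.filter fun i => (v, i) ∈ Q

/-- Membership in a fibre. [folklore] -/
theorem mem_fibre {Q : Finset (Fin n × Fin (d + 1))} {v : Fin n} {i : Fin (d + 1)} : i ∈ fibre Q v ↔ (v, i) ∈ Q := by
  simp [fibre]

/-- The FULL cycles of `Q`. [folklore] -/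
def full (Q : Finset (Fin n × Fin (d + 1))) : Finset (Fin n) := univ.filter fun v => fibre Q v = univ

/-- The PARTIAL cycles of `Q`. [folklore] -/
def partial' (Q : Finset (Fin n × Fin (d + 1))) : Finset (Fin n) :=
  univ.filter fun v => (fibre Q v).Nonempty ∧ fibre Q v ≠ univ

/-- Membership in `full`. [folklore] -/
theorem mem_full {Q : Finset (Fin n × Fin (d + 1))} {v : Fin n} : v ∈ full Q ↔ fibre Q v = univ := by simp [full]

/-- Membership in `partial'`. [folklore] -/
theorem mem_partial {Q : Finset (Fin n × Fin (d + 1))} {v : Fin n} :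
    v ∈ partial' Q ↔ (fibre Q v).Nonempty ∧ fibre Q v ≠ univ := by simp [partial']

/-- A vertex of `Q` lies in a full or a partial cycle. [folklore] -/
theorem mem_full_or_partial {Q : Finset (Fin n × Fin (d + 1))} {y : Fin n × Fin (d + 1)} (hy : y ∈ Q) :
    y.1 ∈ full Q ∨ y.1 ∈ partial' Q := by
  by_cases h : fibre Q y.1 = univ
  · exact Or.inl (mem_full.2 h)
  · exact Or.inr (mem_partial.2 ⟨⟨y.2, mem_fibre.2 hy⟩, h⟩)

/-- `|Q| = ∑_v |fibre v|`. [folklore] -/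
theorem card_eq_sum_fibre (Q : Finset (Fin n × Fin (d + 1))) : Q.card = ∑ v, (fibre Q v).card := by
  rw [Finset.card_eq_sum_card_fiberwise (f := fun y : Fin n × Fin (d + 1) => y.1) (t := univ) (fun _ _ => mem_univ _)]
  refine Finset.sum_congr rfl fun v _ => ?_
  refine Finset.card_bij (fun y _ => y.2) (fun y hy => ?_) (fun y hy y' hy' h => ?_) (fun i hi => ?_)
  · rw [Finset.mem_filter] at hy; rw [mem_fibre, ← hy.2]; exact hy.1
  · rw [Finset.mem_filter] at hy hy'; exact Prod.ext (hy.2.trans hy'.2.symm) h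
  · exact ⟨(v, i), Finset.mem_filter.2 ⟨mem_fibre.1 hi, rfl⟩, rfl⟩

/-- **`|Q| ≤ (d+1)(|full| + |partial|)`.** [folklore] -/
theorem card_le_full_partial (Q : Finset (Fin n × Fin (d + 1))) :
    Q.card ≤ (d + 1) * ((full Q).card + (partial' Q).card) := by
  rw [card_eq_sum_fibre]
  have h1 : ∑ v, (fibre Q v).card = ∑ v ∈ full Q ∪ partial' Q, (fibre Q v).card := by
    symm
    refine Finset.sum_subset (Finset.subset_univ _) fun v _ hv => ?_
    rw [Finset.mem_union, not_or, mem_full, mem_partial, not_and_or, not_not, Finset.not_nonempty_iff_eq_empty] at hv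
    rcases hv.2 with h | h
    · rw [h, Finset.card_empty]
    · exact absurd h hv.1
  rw [h1]
  calc ∑ v ∈ full Q ∪ partial' Q, (fibre Q v).card ≤ ∑ _v ∈ full Q ∪ partial' Q, (d + 1) :=
        Finset.sum_le_sum fun v _ => (Finset.card_le_univ _).trans (by rw [Fintype.card_fin])
    _ = (full Q ∪ partial' Q).card * (d + 1) := by rw [Finset.sum_const, smul_eq_mul]
    _ ≤ ((full Q).card + (partial' Q).card) * (d + 1) := Nat.mul_le_mul_right _ (Finset.card_union_le _ _)
    _ = (d + 1) * ((full Q).card + (partial' Q).card) := Nat.mul_comm _ _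

/-- `(d+1)|full| ≤ |Q|`. [folklore] -/
theorem full_mul_le_card (Q : Finset (Fin n × Fin (d + 1))) : (d + 1) * (full Q).card ≤ Q.card := by
  rw [card_eq_sum_fibre, Nat.mul_comm]
  calc (full Q).card * (d + 1) = ∑ _v ∈ full Q, (d + 1) := by rw [Finset.sum_const, smul_eq_mul]
    _ = ∑ v ∈ full Q, (fibre Q v).card := Finset.sum_congr rfl fun v hv => by
        rw [mem_full.1 hv, Finset.card_univ, Fintype.card_fin]
    _ ≤ ∑ v, (fibre Q v).card := Finset.sum_le_sum_of_subset (Finset.subset_univ _)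

/-- A non-empty subset of `Fin (d+1)` closed under successor is everything. [folklore] -/
theorem eq_univ_of_succ_closed {S : Finset (Fin (d + 1))} (hS : S.Nonempty) (h : ∀ i ∈ S, i + 1 ∈ S) : S = univ := by
  obtain ⟨i₀, hi₀⟩ := hS
  let f : ℕ → Fin (d + 1) := fun t => ⟨(i₀.val + t) % (d + 1), Nat.mod_lt _ (Nat.succ_pos d)⟩
  have hf : ∀ t, f t ∈ S := by
    intro t
    induction t with
    | zero =>
      have : f 0 = i₀ := Fin.ext (by simp [f, Nat.mod_eq_of_lt i₀.2])
      rw [this]; exact hi₀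
    | succ t ih =>
      have : f (t + 1) = f t + 1 := by
        apply Fin.ext
        simp only [f, Fin.val_add]
        rw [Fin.val_one', ← add_assoc, Nat.add_mod (i₀.val + t) 1]
      rw [this]; exact h _ ih
  rw [Finset.eq_univ_iff_forall]
  intro j
  have := hf (j.val + (d + 1) - i₀.val)
  have hj : f (j.val + (d + 1) - i₀.val) = j := by
    apply Fin.ext
    simp only [f]
    rw [Nat.add_sub_cancel' (by have := i₀.2; omega), Nat.add_mod_right, Nat.mod_eq_of_lt j.2]
  rwa [hj] at this

/-- A proper non-empty subset of a cycle has an element whose successor is outside. [folklore] -/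
theorem exists_succ_notMem {S : Finset (Fin (d + 1))} (hS : S.Nonempty) (hS' : S ≠ univ) : ∃ i ∈ S, i + 1 ∉ S := by
  by_contra h
  push Not at h
  exact hS' (eq_univ_of_succ_closed hS h)

/-- A proper non-empty subset of a cycle has an element whose predecessor is outside. [folklore] -/
theorem exists_pred_notMem {S : Finset (Fin (d + 1))} (hS : S.Nonempty) (hS' : S ≠ univ) : ∃ i ∈ S, i - 1 ∉ S := by
  by_contra h
  push Not at h
  -- closure under predecessor gives closure under successor (finite set, injective map)
  apply hS' (eq_univ_of_succ_closed hS fun i hi => ?_)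
  have hsub : S.image (fun i => i - 1) ⊆ S := by
    intro x hx
    rw [Finset.mem_image] at hx
    obtain ⟨i, hi, rfl⟩ := hx
    exact h i hi
  have hcard : S.card ≤ (S.image fun i => i - 1).card := by
    rw [Finset.card_image_of_injective _ (fun a b hab => sub_left_injective hab)]
  have heq := Finset.eq_of_subset_of_card_le hsub hcard
  have : i ∈ S.image fun i => i - 1 := by rw [heq]; exact hi
  rw [Finset.mem_image] at this
  obtain ⟨j, hj, hji⟩ := this
  have : j = i + 1 := by rw [← hji, sub_add_cancel]
  rw [← this]; exact hj

/-- **Every partial cycle has two leaving cycle darts.** [folklore] -/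
theorem two_mul_partial_le (Q : Finset (Fin n × Fin (d + 1))) :
    2 * (partial' Q).card ≤ ((leavingF (cycFun R') Q).filter fun x => x.2 ≠ 2).card := by
  -- choose, for each partial cycle, an exit forwards and an exit backwards
  have hs : ∀ v : ↥(partial' Q), ∃ i ∈ fibre Q v.1, i + 1 ∉ fibre Q v.1 := fun v =>
    exists_succ_notMem (mem_partial.1 v.2).1 (mem_partial.1 v.2).2
  have hp : ∀ v : ↥(partial' Q), ∃ i ∈ fibre Q v.1, i - 1 ∉ fibre Q v.1 := fun v =>
    exists_pred_notMem (mem_partial.1 v.2).1 (mem_partial.1 v.2).2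
  choose ip hip hip' using hs
  choose im him him' using hp
  let A : Finset ((Fin n × Fin (d + 1)) × Fin 3) := univ.image fun v : ↥(partial' Q) => ((v.1, ip v), 1)
  let B : Finset ((Fin n × Fin (d + 1)) × Fin 3) := univ.image fun v : ↥(partial' Q) => ((v.1, im v), 0)
  have hA : A.card = (partial' Q).card := by
    rw [Finset.card_image_of_injective, Finset.card_univ, Fintype.card_coe]
    intro v w h
    exact Subtype.ext (congrArg (fun x => x.1.1) h)
  have hB : B.card = (partial' Q).card := by
    rw [Finset.card_image_of_injective, Finset.card_univ, Fintype.card_coe]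
    intro v w h
    exact Subtype.ext (congrArg (fun x => x.1.1) h)
  have hAB : Disjoint A B := by
    rw [Finset.disjoint_left]
    intro x hx hx'
    rw [Finset.mem_image] at hx hx'
    obtain ⟨v, -, rfl⟩ := hx
    obtain ⟨w, -, h⟩ := hx'
    have := congrArg Prod.snd h
    simp at this
  have hsub : A ∪ B ⊆ (leavingF (cycFun R') Q).filter fun x => x.2 ≠ 2 := by
    intro x hx
    rw [Finset.mem_union, Finset.mem_image, Finset.mem_image] at hx
    rw [Finset.mem_filter, mem_leavingF]
    rcases hx with ⟨v, -, rfl⟩ | ⟨v, -, rfl⟩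
    · refine ⟨⟨mem_fibre.1 (hip v), ?_⟩, (by decide : (1 : Fin 3) ≠ 2)⟩
      rw [cycFun_one]; exact fun h => hip' v (mem_fibre.2 h)
    · refine ⟨⟨mem_fibre.1 (him v), ?_⟩, (by decide : (0 : Fin 3) ≠ 2)⟩
      rw [cycFun_zero]; exact fun h => him' v (mem_fibre.2 h)
  calc 2 * (partial' Q).card = A.card + B.card := by rw [hA, hB]; ring
    _ = (A ∪ B).card := (Finset.card_union_of_disjoint hAB).symm
    _ ≤ _ := Finset.card_le_card hsub

/-- **The `R'`-darts leaving from full cycles**, minus those absorbed by partial cycles. [folklore] -/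
theorem leaving_full_le (Q : Finset (Fin n × Fin (d + 1))) :
    (leaving R' (full Q)).card ≤ ((leavingF (cycFun R') Q).filter fun x => x.2 = 2).card + (d + 1) * (partial' Q).card := by
  -- split the leaving darts of `full Q` by whether their reverse lands in `Q`
  have hsplit := (Finset.card_filter_add_card_filter_not (s := leaving R' (full Q)) (fun y => R'.rot y ∉ Q))
  rw [← hsplit]
  refine Nat.add_le_add ?_ ?_
  · -- those landing outside `Q` leave `Q` along label `2`
    refine Finset.card_le_card_of_injOn (fun y => (y, 2)) (fun y hy => ?_) (fun y _ y' _ h => congrArg Prod.fst h)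
    rw [Finset.mem_coe, Finset.mem_filter, mem_leaving, mem_full] at hy
    rw [Finset.mem_coe, Finset.mem_filter, mem_leavingF]
    refine ⟨⟨?_, ?_⟩, rfl⟩
    · have : y.2 ∈ fibre Q y.1 := by rw [hy.1.1]; exact mem_univ _
      exact mem_fibre.1 this
    · rw [cycFun_two]; exact hy.2
  · -- those landing inside `Q` land in a partial cycle; `rot` is injective
    simp only [not_not]
    refine le_trans (Finset.card_le_card_of_injOn R'.rot (fun y hy => ?_) (fun y _ y' _ h => ?_))
      ((card_le_full_partial_aux Q).trans le_rfl)
    · rw [Finset.mem_coe, Finset.mem_filter, mem_leaving, mem_full] at hy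
      rw [Finset.mem_coe, Finset.mem_filter]
      refine ⟨hy.2, ?_⟩
      rcases mem_full_or_partial hy.2 with h | h
      · exact absurd h hy.1.2
      · exact h
    · have := congrArg R'.rot h; rwa [R'.rot_rot, R'.rot_rot] at this
where
  /-- The vertices of `Q` in partial cycles are at most `(d+1)|partial|`. [folklore] -/
  card_le_full_partial_aux (Q : Finset (Fin n × Fin (d + 1))) :
      (Q.filter fun y => y.1 ∈ partial' Q).card ≤ (d + 1) * (partial' Q).card := by
    rw [Finset.card_eq_sum_card_fiberwise (f := fun y : Fin n × Fin (d + 1) => y.1) (t := partial' Q)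
      (s := Q.filter fun y => y.1 ∈ partial' Q) (fun y hy => (Finset.mem_filter.1 (Finset.mem_coe.1 hy)).2)]
    calc ∑ v ∈ partial' Q, ((Q.filter fun y => y.1 ∈ partial' Q).filter fun y => y.1 = v).card
        ≤ ∑ _v ∈ partial' Q, (d + 1) := Finset.sum_le_sum fun v _ => by
          refine le_trans (Finset.card_le_card_of_injOn Prod.snd (fun y _ => Finset.mem_coe.2 (mem_univ _))
            (fun y hy y' hy' h => ?_)) (by rw [Finset.card_univ, Fintype.card_fin])
          rw [Finset.mem_coe, Finset.mem_filter] at hy hy'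
          exact Prod.ext (hy.2.trans hy'.2.symm) h
      _ = (d + 1) * (partial' Q).card := by rw [Finset.sum_const, smul_eq_mul, Nat.mul_comm]

/-- **Edge expansion of the cycle replacement.** [folklore] -/
theorem leavingF_cyc_expand {η : ℝ} (hR' : EdgeExpansion R' η) (Q : Finset (Fin n × Fin (d + 1)))
    (hQ : 2 * Q.card ≤ n * (d + 1)) :
    min 1 (η / (d + 3)) / (d + 1) * Q.card ≤ ((leavingF (cycFun R') Q).card : ℝ) := by
  have hη := hR'.pos
  set f := (full Q).card with hf
  set p := (partial' Q).card with hp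
  have hd1 : (0 : ℝ) < d + 1 := by positivity
  have hd3 : (0 : ℝ) < d + 3 := by positivity
  have hμ1 : min 1 (η / (d + 3)) ≤ 1 := min_le_left _ _
  have hμ2 : min 1 (η / (d + 3)) ≤ η / (d + 3) := min_le_right _ _
  have hμ0 : 0 ≤ min 1 (η / (d + 3)) := le_min zero_le_one (div_nonneg hη.le hd3.le)
  -- the two families of leaving darts
  have hsplit := Finset.card_filter_add_card_filter_not (s := leavingF (cycFun R') Q) (fun x => x.2 ≠ 2)
  simp only [not_not] at hsplit
  have hP : (2 : ℝ) * p ≤ ((leavingF (cycFun R') Q).filter fun x => x.2 ≠ 2).card := by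
    exact_mod_cast two_mul_partial_le R' Q
  have hF : ((leaving R' (full Q)).card : ℝ) ≤ ((leavingF (cycFun R') Q).filter fun x => x.2 = 2).card + (d + 1) * p := by
    exact_mod_cast leaving_full_le R' Q
  have hL : (((leavingF (cycFun R') Q).filter fun x => x.2 ≠ 2).card : ℝ) +
      ((leavingF (cycFun R') Q).filter fun x => x.2 = 2).card = (leavingF (cycFun R') Q).card := by
    exact_mod_cast hsplit
  -- `2 f ≤ n`, so `full Q` expands in `R'`
  have h2f : 2 * f ≤ n := by
    have := full_mul_le_card Q
    have h : 2 * ((d + 1) * f) ≤ n * (d + 1) := le_trans (Nat.mul_le_mul_left 2 this) hQ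
    nlinarith
  have hexp : η * f ≤ ((leaving R' (full Q)).card : ℝ) := hR'.expand _ h2f
  have hQle : (Q.card : ℝ) ≤ (d + 1) * (f + p) := by exact_mod_cast card_le_full_partial Q
  -- the target
  have key : min 1 (η / (d + 3)) * (f + p) ≤ ((leavingF (cycFun R') Q).card : ℝ) := by
    set L := ((leavingF (cycFun R') Q).card : ℝ) with hLdef
    have hf0 : (0 : ℝ) ≤ f := Nat.cast_nonneg _
    have hp0 : (0 : ℝ) ≤ p := Nat.cast_nonneg _
    have hc0 : (0 : ℝ) ≤ ((leavingF (cycFun R') Q).filter fun x => x.2 = 2).card := Nat.cast_nonneg _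
    have hLge1 : 2 * (p : ℝ) ≤ L := by linarith
    have hLge2 : η * f + (1 - (d : ℝ)) * p ≤ L := by nlinarith
    by_cases hcase : η * f ≤ (d + 3) * p
    · have h1 : min 1 (η / (d + 3)) * f ≤ p := by
        calc min 1 (η / (d + 3)) * f ≤ η / (d + 3) * f := mul_le_mul_of_nonneg_right hμ2 hf0
          _ = η * f / (d + 3) := by ring
          _ ≤ p := by rw [div_le_iff₀ hd3]; linarith
      have h2 : min 1 (η / (d + 3)) * p ≤ p := by
        calc min 1 (η / (d + 3)) * p ≤ 1 * p := mul_le_mul_of_nonneg_right hμ1 hp0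
          _ = p := one_mul _
      calc min 1 (η / (d + 3)) * (f + p) = min 1 (η / (d + 3)) * f + min 1 (η / (d + 3)) * p := by ring
        _ ≤ p + p := add_le_add h1 h2
        _ = 2 * p := by ring
        _ ≤ L := hLge1
    · push Not at hcase
      have hX0 : 0 ≤ η * f / (d + 3) := div_nonneg (mul_nonneg hη.le hf0) hd3.le
      have hpf : (p : ℝ) ≤ η * f / (d + 3) := by rw [le_div_iff₀ hd3]; linarith
      have h1 : min 1 (η / (d + 3)) * (f + p) ≤ 2 * (η * f / (d + 3)) := by
        have a1 : min 1 (η / (d + 3)) * f ≤ η / (d + 3) * f := mul_le_mul_of_nonneg_right hμ2 hf0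
        have a2 : min 1 (η / (d + 3)) * p ≤ 1 * p := mul_le_mul_of_nonneg_right hμ1 hp0
        have a3 : η / (d + 3) * f = η * f / (d + 3) := by ring
        calc min 1 (η / (d + 3)) * (f + p) = min 1 (η / (d + 3)) * f + min 1 (η / (d + 3)) * p := by ring
          _ ≤ η * f / (d + 3) + p := by linarith
          _ ≤ 2 * (η * f / (d + 3)) := by linarith
      have h2 : 2 * (η * f / (d + 3)) ≤ L := by
        by_cases hd : (1 : ℝ) ≤ d
        · have hm : (d - 1) * (p : ℝ) ≤ (d - 1) * (η * f / (d + 3)) := mul_le_mul_of_nonneg_left hpf (by linarith)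
          have e1 : η * f - (d - 1) * (η * f / (d + 3)) = 4 * (η * f / (d + 3)) := by field_simp; ring
          nlinarith
        · have hd0 : (d : ℝ) = 0 := by
            have : d = 0 := by
              by_contra hne
              exact hd (by exact_mod_cast Nat.one_le_iff_ne_zero.2 hne)
            rw [this]; simp
          rw [hd0] at hLge2
          have e1 : η * f = 3 * (η * f / (0 + 3)) := by ring
          have : (2 : ℝ) * (η * f / (d + 3)) = 2 * (η * f / (0 + 3)) := by rw [hd0]
          rw [this]
          nlinarith
      linarith
  calc min 1 (η / (d + 3)) / (d + 1) * Q.card ≤ min 1 (η / (d + 3)) / (d + 1) * ((d + 1) * (f + p)) :=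
        mul_le_mul_of_nonneg_left hQle (div_nonneg hμ0 hd1.le)
    _ = min 1 (η / (d + 3)) * (f + p) := by field_simp
    _ ≤ _ := key

/-- **Edge expansion of the cycle replacement.** [folklore] -/
theorem edgeExpansion_cyc {η : ℝ} (hR' : EdgeExpansion R' η) :
    EdgeExpansion (cyc R') (min 1 (η / (d + 3)) / (d + 1)) :=
  edgeExpansion_ofFun _ _ _ (div_pos (lt_min zero_lt_one (div_pos hR'.pos (by positivity))) (by positivity))
    fun Q hQ => leavingF_cyc_expand R' hR' Q hQ

/-- **The cycle replacement of a 2-dart-connected rotation map is 2-dart-connected.** [folklore] -/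
theorem twoLeaving_cyc (hR' : TwoLeaving R') : TwoLeaving (cyc R') := by
  refine twoLeaving_ofFun _ _ _ fun Q hQ hQu => ?_
  by_cases hP : (partial' Q).Nonempty
  · have h1 := two_mul_partial_le R' Q
    have h2 : 1 ≤ (partial' Q).card := Finset.card_pos.2 hP
    exact le_trans (by omega) ((h1.trans (Finset.card_filter_le _ _)))
  · rw [Finset.not_nonempty_iff_eq_empty] at hP
    -- no partial cycles: `Q` is the union of its full cycles, a proper non-empty set of them
    have hFne : (full Q).Nonempty := by
      obtain ⟨y, hy⟩ := hQ
      rcases mem_full_or_partial hy with h | h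
      · exact ⟨_, h⟩
      · rw [hP] at h; simp at h
    have hFu : full Q ≠ univ := by
      intro h
      apply hQu
      rw [Finset.eq_univ_iff_forall]
      rintro ⟨v, i⟩
      have : v ∈ full Q := by rw [h]; exact mem_univ v
      rw [mem_full] at this
      exact mem_fibre.1 (by rw [this]; exact mem_univ i)
    have h2 := hR' _ hFne hFu
    refine le_trans h2 (le_trans ?_ (Finset.card_filter_le _ (fun x => x.2 = 2)))
    have := leaving_full_le R' Q
    simp only [hP, Finset.card_empty, mul_zero, add_zero] at this
    exact this

end Cyc

/-! ### The 3-regular base: cycle replacement of the double -/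

section Base

variable {m d : ℕ} (R : RotGraph m d)

/-- The expansion constant of the 3-regular base. [folklore] -/
def η₃ (η : ℝ) (d : ℕ) : ℝ := min 1 (min (1 / 3) (η / 3) / (d + 3)) / (d + 1)

/-- **The 3-regular base** over `R`: the cycle replacement of the double, a rotation map of degree
`3` on `m · 2 · (d+1)` vertices. [folklore] -/
def base3 : RotGraph (m * 2 * (d + 1)) 3 := cyc (dbl R)

/-- The base has no half-edges. [folklore] -/
theorem noFixed_base3 : NoFixed (base3 R) := noFixed_cyc _ (noFixed_dbl R)

/-- **The base is an edge expander** (constant `η₃ η d`). [folklore] -/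
theorem edgeExpansion_base3 {η : ℝ} (hR : EdgeExpansion R η) : EdgeExpansion (base3 R) (η₃ η d) :=
  edgeExpansion_cyc _ (edgeExpansion_dbl R hR)

/-- **The base is 2-dart-connected** (`m ≥ 2`). [folklore] -/
theorem twoLeaving_base3 {η : ℝ} (hR : EdgeExpansion R η) (hm : 2 ≤ m) : TwoLeaving (base3 R) :=
  twoLeaving_cyc _ (twoLeaving_dbl R hR hm)

/-- The expansion constant is positive. [folklore] -/
theorem η₃_pos {η : ℝ} (hη : 0 < η) (d : ℕ) : 0 < η₃ η d := by
  unfold η₃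
  have : (0 : ℝ) < d + 3 := by positivity
  have : (0 : ℝ) < d + 1 := by positivity
  refine div_pos (lt_min zero_lt_one (div_pos (lt_min (by norm_num) (by linarith)) (by positivity))) (by positivity)

end Base

end Literature.ModelTheory.FiniteModelTheory.CFIMatching
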